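import Mathlib

/-!
HONEST FRAMING: exact (Metropolis-corrected) sampling algorithms for lattice gauge theory; figures
of merit are autocorrelation/cost numbers at stated couplings and volumes; no continuum-physics
claim.

# HubChainPerStepCounterexample — PER-STEP DOMINATION FAILS ON THE DIAGONAL: A THREE-PARTICLE HUB CHAIN IN WHICH DEEPENING THE TAGGED PARTICLE RAISES THE TWO-STEP RETURN
# PROBABILITY OF THE START (`7/16 → 1/2`), WHILE THE OFF-DIAGONAL TWO-STEP ENTRY FALLS (`3/8 → 1/4`) (lean-2 GEN-39, ours)

Venture-side (OURS).  Cell `lqcd-flow` (pub-lqcd), unit `pub-lqcd-lean-2-g39`, 2026-08-30.  Chapter Y, file 5 — a typed NEGATIVE for the shape of Conjecture M′ (MEMO-gen37 §5b,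
OPEN-MATH GEN-38 addendum (b′)): the σ-DISCOUNTED hub occupations are antitone in the depth of the tagged particle (chapter W files 24–26, Rayleigh on the diagonal), and the
toy says the PER-STEP occupations of the OTHER particles are antitone too (Conjecture M′); but per step the START particle's own occupation is NOT antitone.  The instance, in the
setting of file 1 (`HubChainEigenbasis`: ranks by non-decreasing depth, `P(i,j) = c·min{1,ρ_j/ρ_i}` off the diagonal, unit row sums): `m = 3`, `c = 1/2`, depths
`ρ^X = (1, 2, 2)` (the tagged particle ★ is rank `0`, the start `z` is rank `1`) against `ρ^Y = (2, 2, 2)` (★ deepened to the common depth; `ρ^X ≤ ρ^Y`, equal off ★):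

* `perStep_X_entries`, `perStep_Y_entries`: the two kernels (`P^X = [[0,½,½],[¼,¼,½],[¼,½,¼]]`, `P^Y = ½(J − I)`);
* **`perStep_diag_rises`**: `(P^X)²(z,z) = 7/16 < 1/2 = (P^Y)²(z,z)` — deepening ★ RAISES the two-step return probability of the start (the round trip `z → ★ → z` is likelier
  when ★ is closer in depth to `z`; in the language of file 2 this is the parity term `β_zⁿ` with `β_z < 0`);
* **`perStep_offdiag_falls`**: `(P^Y)²(z,w) = 1/4 ≤ 3/8 = (P^X)²(z,w)` for the third particle `w` (rank `2`) — the off-diagonal entry behaves as Conjecture M′ predicts.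

So any per-attempt-count (clock-conditioned, file C1) use of domination must treat the start content separately, exactly as OPEN-MATH (b′) words it.  Hypothesis-equations, no
definitions; the numbers are exact rationals.

Reading (no numerics implied): a counterexample to the diagonal form only.  Literature grade (cell rule): OWN; nothing cited; no new bib keys.
-/

open Finset

namespace Summit.Ventures.LatticeQCDFlow.Scaling

section PerStep
variable {ρX ρY : ℕ → ℝ} {PX PY : ℕ → ℕ → ℝ}

/-- The entries of the `X` kernel (`ρ^X = (1,2,2)`, `c = 1/2`). [ours] -/
theorem perStep_X_entries (hρ : ρX 0 = 1 ∧ ρX 1 = 2 ∧ ρX 2 = 2)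
    (hPoff : ∀ i j, i ≠ j → PX i j = (1 / 2 : ℝ) * min 1 (ρX j / ρX i)) (hPdiag : ∀ i, PX i i = 1 - ∑ j ∈ (range 3).erase i, PX i j) :
    PX 0 0 = 0 ∧ PX 0 1 = 1 / 2 ∧ PX 0 2 = 1 / 2 ∧ PX 1 0 = 1 / 4 ∧ PX 1 1 = 1 / 4 ∧ PX 1 2 = 1 / 2 ∧ PX 2 0 = 1 / 4 ∧ PX 2 1 = 1 / 2 ∧ PX 2 2 = 1 / 4 := by
  obtain ⟨h0, h1, h2⟩ := hρ
  have e01 : PX 0 1 = 1 / 2 := by rw [hPoff 0 1 (by norm_num), h0, h1]; norm_num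
  have e02 : PX 0 2 = 1 / 2 := by rw [hPoff 0 2 (by norm_num), h0, h2]; norm_num
  have e10 : PX 1 0 = 1 / 4 := by rw [hPoff 1 0 (by norm_num), h0, h1]; norm_num
  have e12 : PX 1 2 = 1 / 2 := by rw [hPoff 1 2 (by norm_num), h1, h2]; norm_num
  have e20 : PX 2 0 = 1 / 4 := by rw [hPoff 2 0 (by norm_num), h0, h2]; norm_num
  have e21 : PX 2 1 = 1 / 2 := by rw [hPoff 2 1 (by norm_num), h1, h2]; norm_num
  have s3 : ∀ (g : ℕ → ℝ) (i : ℕ), ∑ j ∈ (range 3).erase i, g j = (∑ j ∈ range 3, g j) - (if i < 3 then g i else 0) := by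
    intro g i
    split_ifs with hi
    · rw [← Finset.add_sum_erase _ _ (mem_range.mpr hi)]; ring
    · rw [Finset.erase_eq_of_notMem (by simpa using hi)]; ring
  have e00 : PX 0 0 = 0 := by
    have h := hPdiag 0; rw [s3] at h; simp only [sum_range_succ, sum_range_zero, Nat.zero_lt_succ, if_true] at h; rw [e01, e02] at h; linarith
  have e11 : PX 1 1 = 1 / 4 := by
    have h := hPdiag 1; rw [s3] at h; simp only [sum_range_succ, sum_range_zero, show (1:ℕ) < 3 by norm_num, if_true] at h; rw [e10, e12] at h; linarith
  have e22 : PX 2 2 = 1 / 4 := by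
    have h := hPdiag 2; rw [s3] at h; simp only [sum_range_succ, sum_range_zero, show (2:ℕ) < 3 by norm_num, if_true] at h; rw [e20, e21] at h; linarith
  exact ⟨e00, e01, e02, e10, e11, e12, e20, e21, e22⟩

/-- The entries of the `Y` kernel (`ρ^Y = (2,2,2)`, `c = 1/2`): `½` off the diagonal, `0` on it. [ours] -/
theorem perStep_Y_entries (hρ : ρY 0 = 2 ∧ ρY 1 = 2 ∧ ρY 2 = 2)
    (hPoff : ∀ i j, i ≠ j → PY i j = (1 / 2 : ℝ) * min 1 (ρY j / ρY i)) (hPdiag : ∀ i, PY i i = 1 - ∑ j ∈ (range 3).erase i, PY i j) :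
    PY 0 0 = 0 ∧ PY 0 1 = 1 / 2 ∧ PY 0 2 = 1 / 2 ∧ PY 1 0 = 1 / 2 ∧ PY 1 1 = 0 ∧ PY 1 2 = 1 / 2 ∧ PY 2 0 = 1 / 2 ∧ PY 2 1 = 1 / 2 ∧ PY 2 2 = 0 := by
  obtain ⟨h0, h1, h2⟩ := hρ
  have e01 : PY 0 1 = 1 / 2 := by rw [hPoff 0 1 (by norm_num), h0, h1]; norm_num
  have e02 : PY 0 2 = 1 / 2 := by rw [hPoff 0 2 (by norm_num), h0, h2]; norm_num
  have e10 : PY 1 0 = 1 / 2 := by rw [hPoff 1 0 (by norm_num), h0, h1]; norm_num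
  have e12 : PY 1 2 = 1 / 2 := by rw [hPoff 1 2 (by norm_num), h1, h2]; norm_num
  have e20 : PY 2 0 = 1 / 2 := by rw [hPoff 2 0 (by norm_num), h0, h2]; norm_num
  have e21 : PY 2 1 = 1 / 2 := by rw [hPoff 2 1 (by norm_num), h1, h2]; norm_num
  have s3 : ∀ (g : ℕ → ℝ) (i : ℕ), ∑ j ∈ (range 3).erase i, g j = (∑ j ∈ range 3, g j) - (if i < 3 then g i else 0) := by
    intro g i
    split_ifs with hi
    · rw [← Finset.add_sum_erase _ _ (mem_range.mpr hi)]; ring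
    · rw [Finset.erase_eq_of_notMem (by simpa using hi)]; ring
  have e00 : PY 0 0 = 0 := by
    have h := hPdiag 0; rw [s3] at h; simp only [sum_range_succ, sum_range_zero, Nat.zero_lt_succ, if_true] at h; rw [e01, e02] at h; linarith
  have e11 : PY 1 1 = 0 := by
    have h := hPdiag 1; rw [s3] at h; simp only [sum_range_succ, sum_range_zero, show (1:ℕ) < 3 by norm_num, if_true] at h; rw [e10, e12] at h; linarith
  have e22 : PY 2 2 = 0 := by
    have h := hPdiag 2; rw [s3] at h; simp only [sum_range_succ, sum_range_zero, show (2:ℕ) < 3 by norm_num, if_true] at h; rw [e20, e21] at h; linarith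
  exact ⟨e00, e01, e02, e10, e11, e12, e20, e21, e22⟩

/-- **PER-STEP DOMINATION FAILS ON THE DIAGONAL:** `(P^X)²(z,z) = 7/16 < 1/2 = (P^Y)²(z,z)` for the start `z = ` rank `1`, although `ρ^X ≤ ρ^Y` (equal off the tagged rank `0`). [ours] -/
theorem perStep_diag_rises (hρX : ρX 0 = 1 ∧ ρX 1 = 2 ∧ ρX 2 = 2) (hρY : ρY 0 = 2 ∧ ρY 1 = 2 ∧ ρY 2 = 2)
    (hPXoff : ∀ i j, i ≠ j → PX i j = (1 / 2 : ℝ) * min 1 (ρX j / ρX i)) (hPXdiag : ∀ i, PX i i = 1 - ∑ j ∈ (range 3).erase i, PX i j)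
    (hPYoff : ∀ i j, i ≠ j → PY i j = (1 / 2 : ℝ) * min 1 (ρY j / ρY i)) (hPYdiag : ∀ i, PY i i = 1 - ∑ j ∈ (range 3).erase i, PY i j) :
    (∑ l ∈ range 3, PX 1 l * PX l 1 = 7 / 16) ∧ (∑ l ∈ range 3, PY 1 l * PY l 1 = 1 / 2) ∧ (∑ l ∈ range 3, PX 1 l * PX l 1 < ∑ l ∈ range 3, PY 1 l * PY l 1) := by
  obtain ⟨x00, x01, x02, x10, x11, x12, x20, x21, x22⟩ := perStep_X_entries hρX hPXoff hPXdiag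
  obtain ⟨y00, y01, y02, y10, y11, y12, y20, y21, y22⟩ := perStep_Y_entries hρY hPYoff hPYdiag
  have hX : ∑ l ∈ range 3, PX 1 l * PX l 1 = 7 / 16 := by
    simp only [sum_range_succ, sum_range_zero]; rw [x10, x01, x11, x12, x21]; norm_num
  have hY : ∑ l ∈ range 3, PY 1 l * PY l 1 = 1 / 2 := by
    simp only [sum_range_succ, sum_range_zero]; rw [y10, y01, y11, y12, y21]; norm_num
  exact ⟨hX, hY, by rw [hX, hY]; norm_num⟩

/-- **Off the diagonal the same instance is dominated:** `(P^Y)²(z,w) = 1/4 ≤ 3/8 = (P^X)²(z,w)` (`z = ` rank `1`, `w = ` rank `2`). [ours] -/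
theorem perStep_offdiag_falls (hρX : ρX 0 = 1 ∧ ρX 1 = 2 ∧ ρX 2 = 2) (hρY : ρY 0 = 2 ∧ ρY 1 = 2 ∧ ρY 2 = 2)
    (hPXoff : ∀ i j, i ≠ j → PX i j = (1 / 2 : ℝ) * min 1 (ρX j / ρX i)) (hPXdiag : ∀ i, PX i i = 1 - ∑ j ∈ (range 3).erase i, PX i j)
    (hPYoff : ∀ i j, i ≠ j → PY i j = (1 / 2 : ℝ) * min 1 (ρY j / ρY i)) (hPYdiag : ∀ i, PY i i = 1 - ∑ j ∈ (range 3).erase i, PY i j) :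
    (∑ l ∈ range 3, PX 1 l * PX l 2 = 3 / 8) ∧ (∑ l ∈ range 3, PY 1 l * PY l 2 = 1 / 4) ∧ (∑ l ∈ range 3, PY 1 l * PY l 2 ≤ ∑ l ∈ range 3, PX 1 l * PX l 2) := by
  obtain ⟨x00, x01, x02, x10, x11, x12, x20, x21, x22⟩ := perStep_X_entries hρX hPXoff hPXdiag
  obtain ⟨y00, y01, y02, y10, y11, y12, y20, y21, y22⟩ := perStep_Y_entries hρY hPYoff hPYdiag
  have hX : ∑ l ∈ range 3, PX 1 l * PX l 2 = 3 / 8 := by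
    simp only [sum_range_succ, sum_range_zero]; rw [x10, x02, x11, x12, x22]; norm_num
  have hY : ∑ l ∈ range 3, PY 1 l * PY l 2 = 1 / 4 := by
    simp only [sum_range_succ, sum_range_zero]; rw [y10, y02, y11, y12, y22]; norm_num
  exact ⟨hX, hY, by rw [hX, hY]; norm_num⟩

end PerStep

end Summit.Ventures.LatticeQCDFlow.Scaling
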